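import Summits.FinalStateConjecture.FinalStateConjecture.Theorems.PhotonSphereChannelsChannelsResolveTameDevelopmentsRMorawetzIdentity

/-!
# Crux `WindowedShellChannels` (stmt-FinalStateConjecture-14085), line `Sketch`, stub `stub_outVirial` —
# part 1: the multiplier `f ≡ 1` on the two half-strips `[0, t₁] × (xp, ∞)` and `[0, t₁] × (−∞, xp]`

Helper file for the registered stub `stub_outVirial` (virial law of the characteristic split OUT/IN) of line
`Sketch` of the crux, in the Fréchet-partial bookkeeping of the `…Theorems.WaveEnergy` files: `u : ℝ × ℝ → ℝ`
a `C²` solution of `u_tt − u_xx + Vu = 0`, `e = u_t² + u_x² + Vu²`, `V ≥ 0` of class `C¹`, `|V′| ≤ K V`.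
The multiplier identity `WaveEnergy.multiplier_identity_rect` with `f ≡ 1, β ≡ 0, φ = V/2` has current
`P = u_t u_x`, flux `Q = ½(u_t² + u_x²) − ½Vu²` and bulk `B = −½V′u²` (`rect`).  If every slice `e(t, ·)`
has the same finite `lintegral` `E₀` (conservation of energy, supplied by the user), then `e`, `P`, `B` are
integrable on slices and on the strip `(0, t₁] × ℝ` (`|P| ≤ ½e`, `|B| ≤ ½|K|e`, Tonelli), and letting the
outer end of the rectangle `[0, t₁] × [xp, X]`, resp. `[0, t₁] × [X, xp]`, tend to `±∞` gives the two
**half-strip identities** (`half_strip_identities`)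
`∫_{x>xp} P(t₁,·) − ∫_{x>xp} P(0,·) + ∬_{(0,t₁]×(xp,∞)} B = −∫₀^{t₁} Q(·, xp)`,
`∫_{x≤xp} P(t₁,·) − ∫_{x≤xp} P(0,·) + ∬_{(0,t₁]×(−∞,xp]} B = +∫₀^{t₁} Q(·, xp)`:
the lateral flux `∫₀^{t₁} Q(·, X)` converges (all other terms do) and its limit vanishes, because
`|∫₀^{t₁} Q(·, X)| ≤ ½∫₀^{t₁} e(·, X)` is an integrable function of `X` and an integrable function cannot stay
above a positive constant on a half-line (`eq_zero_of_tendsto`).  Part 2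
(`…WindowedShellChannelsStubOutVirial`) assembles the stub.  Standard material [folklore].
-/

noncomputable section

set_option linter.dupNamespace false

namespace Summit.FinalStateConjecture.FinalStateConjecture.Theorems.WindowedShellChannelsSketch

open Filter Set MeasureTheory
open scoped ENNReal Topology

namespace OutVirial

variable {u : ℝ × ℝ → ℝ} {V V' : ℝ → ℝ} {K : ℝ}

/-- The multiplier identity of `WaveEnergy.multiplier_identity_rect` for `f ≡ 1, β ≡ 0, φ = V/2` on the
rectangle `[0, t₁] × [x₁, x₂]`: `P = u_t u_x`, `Q = ½(u_t² + u_x²) − ½Vu²`, `B = −½V′u²`, and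
`∫_{x₁}^{x₂} P(t₁,·) − ∫_{x₁}^{x₂} P(0,·) + ∫₀^{t₁}∫_{x₁}^{x₂} B = ∫₀^{t₁} Q(·,x₂) − ∫₀^{t₁} Q(·,x₁)`. -/
theorem rect (hu : ContDiff ℝ 2 u) (hV : ∀ x, HasDerivAt V (V' x) x) (hV'c : Continuous V')
    (hsol : ∀ z : ℝ × ℝ, fderiv ℝ (fderiv ℝ u) z (1, 0) (1, 0)
      - fderiv ℝ (fderiv ℝ u) z (0, 1) (0, 1) + V z.2 * u z = 0)
    {P Q Bk : ℝ × ℝ → ℝ}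
    (hP : ∀ z, P z = fderiv ℝ u z (1, 0) * fderiv ℝ u z (0, 1))
    (hQ : ∀ z, Q z = 1 / 2 * (fderiv ℝ u z (1, 0) ^ 2 + fderiv ℝ u z (0, 1) ^ 2)
      - V z.2 / 2 * u z ^ 2)
    (hB : ∀ z, Bk z = -(V' z.2 / 2 * u z ^ 2)) (t₁ x₁ x₂ : ℝ) :
    (∫ x in x₁..x₂, P (t₁, x)) - (∫ x in x₁..x₂, P (0, x))
        + ∫ t in (0:ℝ)..t₁, ∫ x in x₁..x₂, Bk (t, x)
      = (∫ t in (0:ℝ)..t₁, Q (t, x₂)) - ∫ t in (0:ℝ)..t₁, Q (t, x₁) := by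
  have hVc : Continuous V := continuous_iff_continuousAt.2 fun x => (hV x).continuousAt
  have hf : ∀ x : ℝ, HasDerivAt (fun _ : ℝ => (1 : ℝ)) 0 x := fun x => hasDerivAt_const x 1
  have hβ : ∀ x : ℝ, HasDerivAt (fun _ : ℝ => (0 : ℝ)) 0 x := fun x => hasDerivAt_const x 0
  have hφ : ∀ x : ℝ, HasDerivAt (fun y => V y / 2) (V' x / 2) x := fun x => (hV x).div_const 2
  refine WaveEnergy.multiplier_identity_rect (f := fun _ => 1) (f' := fun _ => 0) (β := fun _ => 0)
    (β' := fun _ => 0) (φ := fun y => V y / 2) (φ' := fun y => V' y / 2) hu hVc hsol hf hβ hφ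
    continuous_const continuous_const (hV'c.div_const 2) (P := P) (Q := Q) (Bk := Bk)
    (fun z => ?_) (fun z => ?_) (fun z => ?_) 0 t₁ x₁ x₂
  · simp only [hP]; ring
  · simp only [hQ]; ring
  · simp only [hB]; ring

/-- `Q = ½(u_t² + u_x²) − ½Vu²` is continuous. -/
theorem continuous_Q (hu : ContDiff ℝ 2 u) (hVc : Continuous V) {Q : ℝ × ℝ → ℝ}
    (hQ : ∀ z, Q z = 1 / 2 * (fderiv ℝ u z (1, 0) ^ 2 + fderiv ℝ u z (0, 1) ^ 2)
      - V z.2 / 2 * u z ^ 2) : Continuous Q := by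
  rw [show Q = fun z => 1 / 2 * (fderiv ℝ u z (1, 0) ^ 2 + fderiv ℝ u z (0, 1) ^ 2)
      - V z.2 / 2 * u z ^ 2 from funext hQ]
  have h1 := WaveEnergy.continuous_fderiv_apply hu (1, 0)
  have h2 := WaveEnergy.continuous_fderiv_apply hu (0, 1)
  have h3 := (WaveEnergy.differentiable_of_contDiff_two hu).continuous
  have h4 : Continuous fun z : ℝ × ℝ => V z.2 := hVc.comp continuous_snd
  exact (continuous_const.mul ((h1.pow 2).add (h2.pow 2))).sub ((h4.div_const 2).mul (h3.pow 2))

/-- `|P| ≤ ½e` (`V ≥ 0`). -/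
theorem abs_P_le (hV0 : ∀ x, 0 ≤ V x) {e P : ℝ × ℝ → ℝ}
    (he : ∀ z, e z = (fderiv ℝ u z (1, 0)) ^ 2 + (fderiv ℝ u z (0, 1)) ^ 2 + V z.2 * u z ^ 2)
    (hP : ∀ z, P z = fderiv ℝ u z (1, 0) * fderiv ℝ u z (0, 1)) (z : ℝ × ℝ) :
    |P z| ≤ e z / 2 := by
  have hVu : 0 ≤ V z.2 * u z ^ 2 := mul_nonneg (hV0 z.2) (sq_nonneg _)
  rw [he, hP, abs_le]
  constructor
  · nlinarith [sq_nonneg (fderiv ℝ u z (1, 0) + fderiv ℝ u z (0, 1))]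
  · nlinarith [sq_nonneg (fderiv ℝ u z (1, 0) - fderiv ℝ u z (0, 1))]

/-- `|Q| ≤ ½e` (`V ≥ 0`). -/
theorem abs_Q_le (hV0 : ∀ x, 0 ≤ V x) {e Q : ℝ × ℝ → ℝ}
    (he : ∀ z, e z = (fderiv ℝ u z (1, 0)) ^ 2 + (fderiv ℝ u z (0, 1)) ^ 2 + V z.2 * u z ^ 2)
    (hQ : ∀ z, Q z = 1 / 2 * (fderiv ℝ u z (1, 0) ^ 2 + fderiv ℝ u z (0, 1) ^ 2)
      - V z.2 / 2 * u z ^ 2) (z : ℝ × ℝ) :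
    |Q z| ≤ e z / 2 := by
  have hVu : 0 ≤ V z.2 * u z ^ 2 := mul_nonneg (hV0 z.2) (sq_nonneg _)
  have h2 : 0 ≤ fderiv ℝ u z (1, 0) ^ 2 + fderiv ℝ u z (0, 1) ^ 2 := by positivity
  rw [he, hQ, abs_le]
  constructor
  · nlinarith
  · nlinarith

/-- `|B| ≤ ½|K| e` (`V ≥ 0`, `|V′| ≤ K V`). -/
theorem abs_Bk_le (hV0 : ∀ x, 0 ≤ V x) (hK : ∀ x, |V' x| ≤ K * V x) {e Bk : ℝ × ℝ → ℝ}
    (he : ∀ z, e z = (fderiv ℝ u z (1, 0)) ^ 2 + (fderiv ℝ u z (0, 1)) ^ 2 + V z.2 * u z ^ 2)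
    (hB : ∀ z, Bk z = -(V' z.2 / 2 * u z ^ 2)) (z : ℝ × ℝ) :
    |Bk z| ≤ |K| / 2 * e z := by
  have h3 : 0 ≤ u z ^ 2 := sq_nonneg _
  have h1 : |V' z.2| * u z ^ 2 ≤ |K| * V z.2 * u z ^ 2 :=
    mul_le_mul_of_nonneg_right ((hK z.2).trans
      (mul_le_mul_of_nonneg_right (le_abs_self K) (hV0 z.2))) h3
  have h6 : 0 ≤ |K| * (fderiv ℝ u z (1, 0) ^ 2 + fderiv ℝ u z (0, 1) ^ 2) := by positivity
  have h7 : V' z.2 * u z ^ 2 ≤ |V' z.2| * u z ^ 2 := mul_le_mul_of_nonneg_right (le_abs_self _) h3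
  have h8 : -(V' z.2 * u z ^ 2) ≤ |V' z.2| * u z ^ 2 := by
    rw [← neg_mul]
    exact mul_le_mul_of_nonneg_right (neg_le_abs _) h3
  rw [hB, he, abs_le]
  constructor
  · nlinarith
  · nlinarith

/-- A slice `e(t, ·)` of finite `lintegral` is integrable (`e` continuous, `e ≥ 0`). -/
theorem integrable_slice (hu : ContDiff ℝ 2 u) (hVd : Differentiable ℝ V) (hV0 : ∀ x, 0 ≤ V x)
    {e : ℝ × ℝ → ℝ}
    (he : ∀ z, e z = (fderiv ℝ u z (1, 0)) ^ 2 + (fderiv ℝ u z (0, 1)) ^ 2 + V z.2 * u z ^ 2)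
    {t : ℝ} (hfin : ∫⁻ x, ENNReal.ofReal (e (t, x)) < ⊤) :
    Integrable (fun x => e (t, x)) := by
  have hc : Continuous fun x => e (t, x) :=
    (WaveEnergy.continuous_energyDensity hu hVd he).comp (Continuous.prodMk_right t)
  refine ⟨hc.aestronglyMeasurable, ?_⟩
  rw [hasFiniteIntegral_iff_ofReal (ae_of_all _ fun x => WaveEnergy.energyDensity_nonneg hV0 he (t, x))]
  exact hfin

/-- A slice `P(t, ·)` is integrable when `e(t, ·)` is (`|P| ≤ ½e`). -/
theorem integrable_P_slice (hu : ContDiff ℝ 2 u) (hV0 : ∀ x, 0 ≤ V x) {e P : ℝ × ℝ → ℝ}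
    (he : ∀ z, e z = (fderiv ℝ u z (1, 0)) ^ 2 + (fderiv ℝ u z (0, 1)) ^ 2 + V z.2 * u z ^ 2)
    (hP : ∀ z, P z = fderiv ℝ u z (1, 0) * fderiv ℝ u z (0, 1)) {t : ℝ}
    (hint : Integrable (fun x => e (t, x))) : Integrable (fun x => P (t, x)) := by
  have hc : Continuous fun x => P (t, x) := by
    rw [show (fun x => P (t, x)) = fun x => fderiv ℝ u (t, x) (1, 0) * fderiv ℝ u (t, x) (0, 1)
      from funext fun x => hP (t, x)]
    exact ((WaveEnergy.continuous_fderiv_apply hu (1, 0)).comp (Continuous.prodMk_right t)).mul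
      ((WaveEnergy.continuous_fderiv_apply hu (0, 1)).comp (Continuous.prodMk_right t))
  refine (hint.div_const 2).mono' hc.aestronglyMeasurable (ae_of_all _ fun x => ?_)
  rw [Real.norm_eq_abs]
  exact abs_P_le hV0 he hP (t, x)

/-- Tonelli on the strip `(0, t₁] × ℝ`: if every slice `e(t, ·)` has `lintegral` `E₀ < ∞`, the (continuous,
nonnegative) energy density is integrable on the strip. -/
theorem integrableOn_strip (hu : ContDiff ℝ 2 u) (hVd : Differentiable ℝ V) (hV0 : ∀ x, 0 ≤ V x)
    {e : ℝ × ℝ → ℝ}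
    (he : ∀ z, e z = (fderiv ℝ u z (1, 0)) ^ 2 + (fderiv ℝ u z (0, 1)) ^ 2 + V z.2 * u z ^ 2)
    {E₀ : ℝ≥0∞} (hE₀ : E₀ ≠ ⊤) (hcons : ∀ t, ∫⁻ x, ENNReal.ofReal (e (t, x)) = E₀) (t₁ : ℝ) :
    IntegrableOn e (Ioc 0 t₁ ×ˢ univ) := by
  have hc := WaveEnergy.continuous_energyDensity hu hVd he
  have hm : Measurable fun z => ENNReal.ofReal (e z) := ENNReal.measurable_ofReal.comp hc.measurable
  refine ⟨hc.aestronglyMeasurable, ?_⟩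
  rw [hasFiniteIntegral_iff_ofReal (ae_of_all _ fun z => WaveEnergy.energyDensity_nonneg hV0 he z),
    Measure.volume_eq_prod, ← Measure.restrict_prod_eq_prod_univ, lintegral_prod _ hm.aemeasurable]
  simp only [hcons, lintegral_const, Measure.restrict_apply_univ, Real.volume_Ioc]
  exact ENNReal.mul_lt_top hE₀.lt_top ENNReal.ofReal_lt_top

/-- The bulk `B` is integrable on the strip when `e` is (`|B| ≤ ½|K|e`). -/
theorem integrableOn_Bk_strip (hu : ContDiff ℝ 2 u) (hV'c : Continuous V') (hV0 : ∀ x, 0 ≤ V x)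
    (hK : ∀ x, |V' x| ≤ K * V x) {e Bk : ℝ × ℝ → ℝ}
    (he : ∀ z, e z = (fderiv ℝ u z (1, 0)) ^ 2 + (fderiv ℝ u z (0, 1)) ^ 2 + V z.2 * u z ^ 2)
    (hB : ∀ z, Bk z = -(V' z.2 / 2 * u z ^ 2)) {t₁ : ℝ}
    (hint : IntegrableOn e (Ioc 0 t₁ ×ˢ univ)) : IntegrableOn Bk (Ioc 0 t₁ ×ˢ univ) := by
  have hc : Continuous Bk := by
    rw [show Bk = fun z => -(V' z.2 / 2 * u z ^ 2) from funext hB]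
    exact (((hV'c.comp continuous_snd).div_const 2).mul
      ((WaveEnergy.differentiable_of_contDiff_two hu).continuous.pow 2)).neg
  refine (hint.const_mul (|K| / 2)).mono' hc.aestronglyMeasurable (ae_of_all _ fun z => ?_)
  rw [Real.norm_eq_abs]
  exact abs_Bk_le hV0 hK he hB z

/-- Fubini: the `τ`-integral over `(0, t₁]` of a function integrable on the strip `(0, t₁] × ℝ` is an
integrable function of `x`. -/
theorem integrable_sliceIntegral {f : ℝ × ℝ → ℝ} {t₁ : ℝ} (hint : IntegrableOn f (Ioc 0 t₁ ×ˢ univ)) :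
    Integrable (fun x => ∫ τ in Ioc 0 t₁, f (τ, x)) := by
  rw [IntegrableOn, Measure.volume_eq_prod, ← Measure.restrict_prod_eq_prod_univ] at hint
  exact hint.integral_prod_right

/-- An integrable function cannot dominate a function with a non-zero limit: if `I → M` along a filter `l`
every set of which contains a measurable set of infinite volume on which `h` is integrable, and `|I| ≤ h`,
then `M = 0` (used with `l = atTop, atBot` and `h` integrable on `ℝ`). -/
theorem eq_zero_of_tendsto {I h : ℝ → ℝ} {M : ℝ} {l : Filter ℝ} (hI : Tendsto I l (𝓝 M))
    (hb : ∀ Y, |I Y| ≤ h Y)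
    (hl : ∀ s ∈ l, ∃ S ⊆ s, MeasurableSet S ∧ IntegrableOn h S ∧ volume S = ∞) : M = 0 := by
  by_contra hM
  have hδ : 0 < |M| / 2 := by have := abs_pos.2 hM; linarith
  obtain ⟨S, hSs, hSm, hhS, hSvol⟩ := hl _ ((Metric.tendsto_nhds.1 hI) (|M| / 2) hδ)
  have hconst : IntegrableOn (fun _ => |M| / 2) S :=
    hhS.mono' aestronglyMeasurable_const (ae_restrict_of_forall_mem hSm fun Y hY => by
      have hY' : dist (I Y) M < |M| / 2 := hSs hY
      rw [Real.dist_eq] at hY'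
      have h1 := abs_sub_abs_le_abs_sub M (I Y)
      rw [abs_sub_comm] at h1
      rw [Real.norm_eq_abs, abs_of_pos hδ]
      linarith [hb Y])
  rw [integrableOn_const_iff] at hconst
  rcases hconst with h0 | htop
  · rw [enorm_eq_zero] at h0
    linarith
  · rw [hSvol] at htop
    exact lt_irrefl _ htop

/-- **The two half-strip identities.** For a `C²` solution `u` of `u_tt − u_xx + Vu = 0` (`V ≥ 0` of class
`C¹`, `|V′| ≤ K V`) all of whose slices have the same finite energy `E₀`, `t₁ ≥ 0` and any `xp`:
`∫_{x>xp} P(t₁,·) − ∫_{x>xp} P(0,·) + ∬_{(0,t₁]×(xp,∞)} B = −∫₀^{t₁} Q(·,xp)` and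
`∫_{x≤xp} P(t₁,·) − ∫_{x≤xp} P(0,·) + ∬_{(0,t₁]×(−∞,xp]} B = ∫₀^{t₁} Q(·,xp)`
(the multiplier identity on `[0,t₁] × [xp,X]`, resp. `[0,t₁] × [X,xp]`, and `X → ±∞`: the lateral flux
tends to `0`). [folklore] -/
theorem half_strip_identities (hu : ContDiff ℝ 2 u) (hV : ∀ x, HasDerivAt V (V' x) x)
    (hV'c : Continuous V') (hV0 : ∀ x, 0 ≤ V x) (hK : ∀ x, |V' x| ≤ K * V x)
    (hsol : ∀ z : ℝ × ℝ, fderiv ℝ (fderiv ℝ u) z (1, 0) (1, 0)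
      - fderiv ℝ (fderiv ℝ u) z (0, 1) (0, 1) + V z.2 * u z = 0)
    {e P Q Bk : ℝ × ℝ → ℝ}
    (he : ∀ z, e z = (fderiv ℝ u z (1, 0)) ^ 2 + (fderiv ℝ u z (0, 1)) ^ 2 + V z.2 * u z ^ 2)
    (hP : ∀ z, P z = fderiv ℝ u z (1, 0) * fderiv ℝ u z (0, 1))
    (hQ : ∀ z, Q z = 1 / 2 * (fderiv ℝ u z (1, 0) ^ 2 + fderiv ℝ u z (0, 1) ^ 2)
      - V z.2 / 2 * u z ^ 2)
    (hB : ∀ z, Bk z = -(V' z.2 / 2 * u z ^ 2))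
    {E₀ : ℝ≥0∞} (hE₀ : E₀ ≠ ⊤) (hcons : ∀ t, ∫⁻ x, ENNReal.ofReal (e (t, x)) = E₀)
    {t₁ : ℝ} (ht₁ : 0 ≤ t₁) (xp : ℝ) :
    ((∫ x in Ioi xp, P (t₁, x)) - (∫ x in Ioi xp, P (0, x)) + (∫ z in Ioc 0 t₁ ×ˢ Ioi xp, Bk z)
        = -∫ τ in (0:ℝ)..t₁, Q (τ, xp)) ∧
      ((∫ x in Iic xp, P (t₁, x)) - (∫ x in Iic xp, P (0, x)) + (∫ z in Ioc 0 t₁ ×ˢ Iic xp, Bk z)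
        = ∫ τ in (0:ℝ)..t₁, Q (τ, xp)) := by
  have hVd : Differentiable ℝ V := fun x => (hV x).differentiableAt
  have hec := WaveEnergy.continuous_energyDensity hu hVd he
  have hQc := continuous_Q hu hVd.continuous hQ
  have hfin : ∀ t, ∫⁻ x, ENNReal.ofReal (e (t, x)) < ⊤ := fun t => by
    rw [hcons]; exact hE₀.lt_top
  have hIe : ∀ t, Integrable (fun x => e (t, x)) := fun t => integrable_slice hu hVd hV0 he (hfin t)
  have hIP : ∀ t, Integrable (fun x => P (t, x)) := fun t => integrable_P_slice hu hV0 he hP (hIe t)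
  have hstrip : IntegrableOn e (Ioc 0 t₁ ×ˢ univ) := integrableOn_strip hu hVd hV0 he hE₀ hcons t₁
  have hBstrip : IntegrableOn Bk (Ioc 0 t₁ ×ˢ univ) := integrableOn_Bk_strip hu hV'c hV0 hK he hB hstrip
  have hBsub : ∀ s : Set ℝ, IntegrableOn Bk (Ioc 0 t₁ ×ˢ s) (volume.prod volume) :=
    fun s => hBstrip.mono_set (prod_mono le_rfl (subset_univ _))
  -- the lateral flux is dominated by an integrable function of `X`
  have hbound : ∀ X, |∫ τ in (0:ℝ)..t₁, Q (τ, X)| ≤ ∫ τ in Ioc 0 t₁, e (τ, X) / 2 := by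
    intro X
    rw [← intervalIntegral.integral_of_le ht₁]
    calc |∫ τ in (0:ℝ)..t₁, Q (τ, X)| ≤ ∫ τ in (0:ℝ)..t₁, |Q (τ, X)| :=
          intervalIntegral.abs_integral_le_integral_abs ht₁
      _ ≤ ∫ τ in (0:ℝ)..t₁, e (τ, X) / 2 :=
          intervalIntegral.integral_mono_on ht₁
            ((hQc.comp (Continuous.prodMk_left X)).abs.intervalIntegrable _ _)
            (((hec.comp (Continuous.prodMk_left X)).div_const 2).intervalIntegrable _ _)
            fun τ _ => abs_Q_le hV0 he hQ (τ, X)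
  have hh : Integrable fun X => ∫ τ in Ioc 0 t₁, e (τ, X) / 2 :=
    integrable_sliceIntegral (f := fun z => e z / 2) (hstrip.div_const 2)
  -- the iterated interval integral of the bulk over a rectangle is its set integral
  have hrect : ∀ {a b : ℝ}, a ≤ b → ∫ τ in (0:ℝ)..t₁, ∫ x in a..b, Bk (τ, x)
      = ∫ z in Ioc 0 t₁ ×ˢ Ioc a b, Bk z := fun {a b} hab => by
    rw [intervalIntegral.integral_of_le ht₁]
    simp only [intervalIntegral.integral_of_le hab]
    rw [Measure.volume_eq_prod, setIntegral_prod _ (hBsub _)]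
  refine ⟨?_, ?_⟩
  · -- right half-strip: `X → +∞`
    have hA : ∀ t, Tendsto (fun X => ∫ x in xp..X, P (t, x)) atTop (𝓝 (∫ x in Ioi xp, P (t, x))) :=
      fun t => intervalIntegral_tendsto_integral_Ioi xp (hIP t).integrableOn tendsto_id
    have hBulk : Tendsto (fun X => ∫ τ in (0:ℝ)..t₁, ∫ x in xp..X, Bk (τ, x)) atTop
        (𝓝 (∫ z in Ioc 0 t₁ ×ˢ Ioi xp, Bk z)) := by
      have hU : (⋃ X : ℝ, Ioc (0:ℝ) t₁ ×ˢ Ioc xp X) = Ioc 0 t₁ ×ˢ Ioi xp := by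
        rw [← prod_iUnion, iUnion_Ioc_right]
      have key := tendsto_setIntegral_of_monotone (μ := (volume : Measure (ℝ × ℝ))) (f := Bk)
        (s := fun X : ℝ => Ioc (0:ℝ) t₁ ×ˢ Ioc xp X) (fun X => measurableSet_Ioc.prod measurableSet_Ioc)
        (fun X Y hXY => prod_mono le_rfl (Ioc_subset_Ioc_right hXY)) (by rw [hU]; exact hBsub _)
      rw [hU] at key
      refine key.congr' ?_
      filter_upwards [eventually_ge_atTop xp] with X hX
      exact (hrect hX).symm
    have hflux : Tendsto (fun X => ∫ τ in (0:ℝ)..t₁, Q (τ, X)) atTop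
        (𝓝 ((∫ x in Ioi xp, P (t₁, x)) - (∫ x in Ioi xp, P (0, x))
          + (∫ z in Ioc 0 t₁ ×ˢ Ioi xp, Bk z) + ∫ τ in (0:ℝ)..t₁, Q (τ, xp))) := by
      refine ((((hA t₁).sub (hA 0)).add hBulk).add_const (∫ τ in (0:ℝ)..t₁, Q (τ, xp))).congr ?_
      intro X
      have := rect hu hV hV'c hsol hP hQ hB t₁ xp X
      linarith
    have h0 := eq_zero_of_tendsto hflux hbound fun s hs => by
      obtain ⟨Y₁, hY₁⟩ := mem_atTop_sets.1 hs
      exact ⟨Ioi Y₁, fun Y hY => hY₁ Y (le_of_lt hY), measurableSet_Ioi, hh.integrableOn,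
        Real.volume_Ioi⟩
    linarith
  · -- left half-strip: `X → −∞`
    have hA : ∀ t, Tendsto (fun X => ∫ x in X..xp, P (t, x)) atBot (𝓝 (∫ x in Iic xp, P (t, x))) :=
      fun t => intervalIntegral_tendsto_integral_Iic xp (hIP t).integrableOn tendsto_id
    have hBulk : Tendsto (fun X => ∫ τ in (0:ℝ)..t₁, ∫ x in X..xp, Bk (τ, x)) atBot
        (𝓝 (∫ z in Ioc 0 t₁ ×ˢ Iic xp, Bk z)) := by
      have hU : (⋃ Y : ℝ, Ioc (0:ℝ) t₁ ×ˢ Ioc (-Y) xp) = Ioc 0 t₁ ×ˢ Iic xp := by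
        rw [← prod_iUnion]
        congr 1
        ext x
        simp only [mem_iUnion, mem_Ioc, mem_Iic]
        exact ⟨fun ⟨_, _, h⟩ => h, fun h => ⟨-x + 1, by linarith, h⟩⟩
      have key := tendsto_setIntegral_of_monotone (μ := (volume : Measure (ℝ × ℝ))) (f := Bk)
        (s := fun Y : ℝ => Ioc (0:ℝ) t₁ ×ˢ Ioc (-Y) xp) (fun Y => measurableSet_Ioc.prod measurableSet_Ioc)
        (fun Y₁ Y₂ h => prod_mono le_rfl (Ioc_subset_Ioc_left (neg_le_neg h))) (by rw [hU]; exact hBsub _)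
      rw [hU] at key
      refine (key.comp tendsto_neg_atBot_atTop).congr' ?_
      filter_upwards [eventually_le_atBot xp] with X hX
      simp only [Function.comp_apply, neg_neg]
      exact (hrect hX).symm
    have hflux : Tendsto (fun X => ∫ τ in (0:ℝ)..t₁, Q (τ, X)) atBot
        (𝓝 (-((∫ x in Iic xp, P (t₁, x)) - (∫ x in Iic xp, P (0, x))
          + (∫ z in Ioc 0 t₁ ×ˢ Iic xp, Bk z)) + ∫ τ in (0:ℝ)..t₁, Q (τ, xp))) := by
      refine ((((hA t₁).sub (hA 0)).add hBulk).neg.add_const (∫ τ in (0:ℝ)..t₁, Q (τ, xp))).congr ?_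
      intro X
      have := rect hu hV hV'c hsol hP hQ hB t₁ X xp
      linarith
    have h0 := eq_zero_of_tendsto hflux hbound fun s hs => by
      obtain ⟨Y₁, hY₁⟩ := mem_atBot_sets.1 hs
      exact ⟨Iio Y₁, fun Y hY => hY₁ Y (le_of_lt hY), measurableSet_Iio, hh.integrableOn,
        Real.volume_Iio⟩
    linarith

/-- **Registered sub-goal `stub_outVirial_halfStrip` of stub `stub_outVirial`** (crux
stmt-FinalStateConjecture-14085, line `Sketch`): the two half-strip identities in closed form
(`half_strip_identities`). [folklore] -/
theorem stub_outVirial_halfStrip :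
    ∀ (u : ℝ × ℝ → ℝ) (V V' : ℝ → ℝ) (K : ℝ), ContDiff ℝ 2 u → (∀ x, HasDerivAt V (V' x) x) →
      Continuous V' → (∀ x, 0 ≤ V x) → (∀ x, |V' x| ≤ K * V x) →
      (∀ z : ℝ × ℝ, fderiv ℝ (fderiv ℝ u) z (1, 0) (1, 0) - fderiv ℝ (fderiv ℝ u) z (0, 1) (0, 1)
      + V z.2 * u z = 0) →
      ∀ (e P Q Bk : ℝ × ℝ → ℝ),
      (∀ z, e z = (fderiv ℝ u z (1, 0)) ^ 2 + (fderiv ℝ u z (0, 1)) ^ 2 + V z.2 * u z ^ 2) →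
      (∀ z, P z = fderiv ℝ u z (1, 0) * fderiv ℝ u z (0, 1)) →
      (∀ z, Q z = 1 / 2 * (fderiv ℝ u z (1, 0) ^ 2 + fderiv ℝ u z (0, 1) ^ 2) - V z.2 / 2 * u z ^ 2) →
      (∀ z, Bk z = -(V' z.2 / 2 * u z ^ 2)) →
      ∀ E₀ : ENNReal, E₀ ≠ ⊤ → (∀ t, ∫⁻ x, ENNReal.ofReal (e (t, x)) = E₀) →
      ∀ t₁ : ℝ, 0 ≤ t₁ → ∀ xp : ℝ,
      ((∫ x in Set.Ioi xp, P (t₁, x)) - (∫ x in Set.Ioi xp, P (0, x))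
      + (∫ z in Set.Ioc 0 t₁ ×ˢ Set.Ioi xp, Bk z) = -∫ τ in (0:ℝ)..t₁, Q (τ, xp)) ∧
      ((∫ x in Set.Iic xp, P (t₁, x)) - (∫ x in Set.Iic xp, P (0, x))
      + (∫ z in Set.Ioc 0 t₁ ×ˢ Set.Iic xp, Bk z) = ∫ τ in (0:ℝ)..t₁, Q (τ, xp)) :=
  fun _ _ _ _ hu hV hV'c hV0 hK hsol _ _ _ _ he hP hQ hB _ hE₀ hcons _ ht₁ xp =>
    half_strip_identities hu hV hV'c hV0 hK hsol he hP hQ hB hE₀ hcons ht₁ xp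

end OutVirial

end Summit.FinalStateConjecture.FinalStateConjecture.Theorems.WindowedShellChannelsSketch

end
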